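import Summits.MatrixMultiplication.OmegaCensus.SmallFormats.MatMul228GF3K4Codes
import Summits.MatrixMultiplication.OmegaCensus.SmallFormats.MatMul22nZKEntries
import Summits.MatrixMultiplication.OmegaCensus.SmallFormats.MatMul22nInvertibleAtPairs
import HarnessLib

/-!
# ω-census family (a): the NON-ZERO entries of the K4 certificates — kind RZ (explicit ZKKI Y-form against a term of the same all-ones column)

Cell `pub-omega` (unit `pub-omega-tensor`, gen 42), topic `Summits/MatrixMultiplication/OmegaCensus` (sub-folder `SmallFormats`). Framing (verbatim): lottery
ticket; floor = certified bounds/negative ranges. HONEST FRAMING: step 2b (non-zero half, first kind) of the kernel route to «K4 is not an X-marginal»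
(K4-KERNEL-BLUEPRINT.md §8), on the family-form structure data (as in `K4EntryZeros`). `Q_ne_zero_RZ`: `t` = the ZKKI single at `(vt, μ)` (`vt ∈ {0,1}`, `μ ∈ {1,3}`;
explicit shape `Grow q t = (e·rep D q) • Σ rep r l • c vt l`, `e ≠ 0`, `r ≠ r₀ =` the null representative of the block `(vt, μ)`), `s` = the term of the same
all-ones column `μ` at a row `vs ≠ vt`, the code condition `K4Defs.kills (colcode μ) vs vt = false`, and the point condition
`rep D ⬝ᵥ (Y *ᵥ rep vt) ≠ 0` ⇒ `Σ_{p,q} Y q p (W_s p ⬝ᵥ Grow_t q) ≠ 0`. Proof: `ZKEntries.Q_ne_zero_iff` (cheapness of `s` for row `vt`); `z ≠ 0` by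
`z_ne_zero_of_det` (pair cell: `InvertibleAtPairs.det_ne_zero_col`, `RowSubcomp.sees_cheap_output`) or `z_ne_zero_of_rankOne` + `kcov_dot_ne_zero` (rank-one cell,
`K4Codes.offpair_data`). The mirror kind CZ and the assembly remain. Nothing here is a bound on `ω`.
-/

namespace Summit.MatrixMultiplication.OmegaCensus.SmallFormats

open Finset Matrix
open Literature.Computability.AlgebraicComplexity

namespace K4EntryNonzero

/-- Cell-table facts used below: the term of a single cell lies in its own row and column plane and in no other row plane; cardinalities. -/
theorem aux_facts :
    (∀ s : Fin 4 × Fin 4, K4Defs.singleB s = true → K4Defs.cellTerm s.1 s.2 ∈ (![{15, 16, 17, 18}, {11, 12, 13, 14}, {23, 24, 25, 26}, {19, 20, 21, 22}] : Fin 4 → Finset (Fin 27)) s.1 ∧ K4Defs.cellTerm s.1 s.2 ∈ (![{16, 17, 20, 24}, {11, 15, 19, 23}, {13, 14, 22, 26}, {12, 18, 21, 25}] : Fin 4 → Finset (Fin 27)) s.2 ∧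
      (∀ v : Fin 4, v ≠ s.1 → K4Defs.cellTerm s.1 s.2 ∉ (![{15, 16, 17, 18}, {11, 12, 13, 14}, {23, 24, 25, 26}, {19, 20, 21, 22}] : Fin 4 → Finset (Fin 27)) v) ∧ (∀ μ : Fin 4, μ ≠ s.2 → K4Defs.cellTerm s.1 s.2 ∉ (![{16, 17, 20, 24}, {11, 15, 19, 23}, {13, 14, 22, 26}, {12, 18, 21, 25}] : Fin 4 → Finset (Fin 27)) μ)) ∧
    (∀ v : Fin 4, ((![{15, 16, 17, 18}, {11, 12, 13, 14}, {23, 24, 25, 26}, {19, 20, 21, 22}] : Fin 4 → Finset (Fin 27)) v).card = 4) ∧ (∀ μ : Fin 4, ((![{16, 17, 20, 24}, {11, 15, 19, 23}, {13, 14, 22, 26}, {12, 18, 21, 25}] : Fin 4 → Finset (Fin 27)) μ).card = 4) ∧ (∀ j : Fin 4, (![-((![![1, 0], ![0, 1], ![1, 1], ![1, 2]] : Fin 4 → Fin 2 → ZMod 3) j 1), (![![1, 0], ![0, 1], ![1, 1], ![1, 2]] : Fin 4 → Fin 2 → ZMod 3) j 0] : Fin 2 → ZMod 3) ≠ 0)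 := by
  unfold K4Defs.singleB K4Defs.cellTerm
  refine ⟨by decide, by decide, by decide, by decide⟩

/-- **Non-zero entry, kind RZ.** -/
theorem Q_ne_zero_RZ (β : BilinComp (mulBilin (ZMod 3) 2 2 8) (Fin 27)) (c b : Fin 4 → Fin 2 → (Fin 8 → ZMod 3))
    (hci : ∀ v (a : Fin 2 → ZMod 3), ∑ m, a m • c v m = 0 → ∀ m, a m = 0)
    (hcch : ∀ v t, t ∉ (![{15, 16, 17, 18}, {11, 12, 13, 14}, {23, 24, 25, 26}, {19, 20, 21, 22}] : Fin 4 → Finset (Fin 27)) v → ∀ m, ∑ i, c v m i * (Matrix.vecMul (![-((![![1, 0], ![0, 1], ![1, 1], ![1, 2]] : Fin 4 → Fin 2 → ZMod 3) v 1), (![![1, 0], ![0, 1], ![1, 1], ![1, 2]] : Fin 4 → Fin 2 → ZMod 3) v 0] : Fin 2 → ZMod 3) (β.w t)) i = 0)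
    (hbr : ∀ μ s, s ∈ (![{16, 17, 20, 24}, {11, 15, 19, 23}, {13, 14, 22, 26}, {12, 18, 21, 25}] : Fin 4 → Finset (Fin 27)) μ → ∀ κ : Fin 2, ∃ a : Fin 2 → ZMod 3, β.w s κ = ∑ m, a m • b μ m)
    (Mcol : Fin 4 → Fin 4 → Fin 4) (colcode : Fin 4 → Fin 9)
    (hMa : ∀ μ : Fin 4, (μ = 1 ∨ μ = 3) → ∀ i m, (∑ l, (![![1, 0], ![0, 1], ![1, 1], ![1, 2]] : Fin 4 → Fin 2 → ZMod 3) (Mcol μ i) l • b μ l) ⬝ᵥ c i m = 0)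
    (hMb : ∀ μ : Fin 4, (μ = 1 ∨ μ = 3) → ∀ i (y : Fin 2 → ZMod 3), (∀ m, (∑ l, y l • b μ l) ⬝ᵥ c i m = 0) → (y 0 * (![![1, 0], ![0, 1], ![1, 1], ![1, 2]] : Fin 4 → Fin 2 → ZMod 3) (Mcol μ i) 1 - y 1 * (![![1, 0], ![0, 1], ![1, 1], ![1, 2]] : Fin 4 → Fin 2 → ZMod 3) (Mcol μ i) 0) = 0)
    (hMf : ∀ μ : Fin 4, (μ = 1 ∨ μ = 3) → ∀ a bb i, a ≠ bb → Mcol μ a = Mcol μ bb → i ≠ a → i ≠ bb →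
      ∃ ω : Fin 2 → ZMod 3, ∀ q : Fin 2, β.w (K4Defs.cellTerm i μ) q = ω q • ∑ l, (![![1, 0], ![0, 1], ![1, 1], ![1, 2]] : Fin 4 → Fin 2 → ZMod 3) (Mcol μ a) l • b μ l)
    (hcolcode : ∀ μ : Fin 4, (μ = 1 ∨ μ = 3) → ∀ a bb : Fin 4, Mcol μ a = Mcol μ bb ↔ K4Defs.same (colcode μ) a bb = true)
    (hZKrow : ∀ v μ : Fin 4, (v = 0 ∨ v = 1) → (μ = 1 ∨ μ = 3) → ∃ (e : ZMod 3) (r r₀ : Fin 4), e ≠ 0 ∧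
      (∀ q : Fin 2, (fun jj => β.g (K4Defs.cellTerm v μ) (Matrix.single q jj (1 : ZMod 3))) = (e * (![![1, 0], ![0, 1], ![1, 1], ![1, 2]] : Fin 4 → Fin 2 → ZMod 3) ((![0, 2, 0, 0] : Fin 4 → Fin 4) v) q) • ∑ l, (![![1, 0], ![0, 1], ![1, 1], ![1, 2]] : Fin 4 → Fin 2 → ZMod 3) r l • c v l) ∧
      r ≠ r₀ ∧ Matrix.vecMul ((![![1, 0], ![0, 1], ![1, 1], ![1, 2]] : Fin 4 → Fin 2 → ZMod 3) r₀) (Matrix.of fun l m => c v l ⬝ᵥ b μ m : Matrix (Fin 2) (Fin 2) (ZMod 3)) = 0 ∧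
      (∀ x : Fin 2 → ZMod 3, Matrix.vecMul x (Matrix.of fun l m => c v l ⬝ᵥ b μ m : Matrix (Fin 2) (Fin 2) (ZMod 3)) = 0 → (x 0 * (![![1, 0], ![0, 1], ![1, 1], ![1, 2]] : Fin 4 → Fin 2 → ZMod 3) r₀ 1 - x 1 * (![![1, 0], ![0, 1], ![1, 1], ![1, 2]] : Fin 4 → Fin 2 → ZMod 3) r₀ 0) = 0))
    (Y : Matrix (Fin 2) (Fin 2) (ZMod 3)) (vt μ vs : Fin 4) (hvt : vt = 0 ∨ vt = 1) (hμ : μ = 1 ∨ μ = 3) (hvs : vs ≠ vt)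
    (hsingle : K4Defs.singleB (vs, μ) = true)
    (hkill : K4Defs.kills (colcode μ) vs vt = false)
    (hY : (![![1, 0], ![0, 1], ![1, 1], ![1, 2]] : Fin 4 → Fin 2 → ZMod 3) ((![0, 2, 0, 0] : Fin 4 → Fin 4) vt) ⬝ᵥ (Y *ᵥ (![![1, 0], ![0, 1], ![1, 1], ![1, 2]] : Fin 4 → Fin 2 → ZMod 3) vt) ≠ 0) :
    (∑ p, ∑ q, Y q p * (β.w (K4Defs.cellTerm vs μ) p ⬝ᵥ (fun jj => β.g (K4Defs.cellTerm vt μ) (Matrix.single q jj (1 : ZMod 3))))) ≠ 0 := by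
  classical
  obtain ⟨hcell, hR4, hC4, hnu⟩ := aux_facts
  obtain ⟨hsR, hsC, hsR', -⟩ := hcell (vs, μ) hsingle
  simp only at hsR hsC hsR'
  set s := K4Defs.cellTerm vs μ with hsdef
  set t := K4Defs.cellTerm vt μ with htdef
  obtain ⟨e, r, r₀, he, hshape, hrr₀, hr₀, hr₀max⟩ := hZKrow vt μ hvt hμ
  -- the output coefficient matrix of `s` in the frame `b μ`
  have hΩex : ∃ Ω : Matrix (Fin 2) (Fin 2) (ZMod 3), ∀ κ, β.w s κ = ∑ l, Ω κ l • b μ l := by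
    choose a ha using hbr μ s hsC
    exact ⟨Matrix.of fun κ l => a κ l, fun κ => ha κ⟩
  obtain ⟨Ω, hΩ⟩ := hΩex
  -- cheapness of `s` for the row plane of `t`
  have hcheap := hcch vt s (hsR' vt (Ne.symm hvs))
  -- maximality of the null line of the block `(vt, μ)` in combination form
  have hmax : ∀ x : Fin 2 → ZMod 3, (∀ m, (∑ l, x l • c vt l) ⬝ᵥ b μ m = 0) → (x 0 * (![![1, 0], ![0, 1], ![1, 1], ![1, 2]] : Fin 4 → Fin 2 → ZMod 3) r₀ 1 - x 1 * (![![1, 0], ![0, 1], ![1, 1], ![1, 2]] : Fin 4 → Fin 2 → ZMod 3) r₀ 0) = 0 := by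
    intro x hx
    refine hr₀max x ?_
    funext m; rw [← GramNondeg.combo_dotProduct_eq_vecMul]; exact hx m
  -- the kill vector of `t` is not orthogonal to the column plane `b μ`
  have hu : ∃ l, b μ l ⬝ᵥ (∑ m, (![![1, 0], ![0, 1], ![1, 1], ![1, 2]] : Fin 4 → Fin 2 → ZMod 3) r m • c vt m) ≠ 0 := ZKEntries.exists_b_dot_ne_zero (c vt) (b μ) r r₀ hrr₀ hmax
  -- the z-vector is non-zero: by the kind of `s` in the all-ones column `μ`
  have hz : (fun p => β.w s p ⬝ᵥ ∑ m, (![![1, 0], ![0, 1], ![1, 1], ![1, 2]] : Fin 4 → Fin 2 → ZMod 3) r m • c vt m) ≠ 0 := by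
    by_cases hpm : K4Defs.pairMask (colcode μ) vs = true
    · -- pair cell: Ω invertible
      obtain ⟨bb, cc, dd, h1, h2, h3, h4, h5, h6, hsab, hsac, hsad, hscd⟩ := K4Codes.pair_data (colcode μ) vs hpm
      have hMab : Mcol μ vs = Mcol μ bb := (hcolcode μ hμ vs bb).mpr hsab
      have hMac : Mcol μ vs ≠ Mcol μ cc := fun h => by have := (hcolcode μ hμ vs cc).mp h; rw [hsac] at this; exact Bool.false_ne_true this
      have hMad : Mcol μ vs ≠ Mcol μ dd := fun h => by have := (hcolcode μ hμ vs dd).mp h; rw [hsad] at this; exact Bool.false_ne_true this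
      have hMcd : Mcol μ cc ≠ Mcol μ dd := fun h => by have := (hcolcode μ hμ cc dd).mp h; rw [hscd] at this; exact Bool.false_ne_true this
      have hsees := RowSubcomp.sees_cheap_output β _ (hnu vs) ((![{15, 16, 17, 18}, {11, 12, 13, 14}, {23, 24, 25, 26}, {19, 20, 21, 22}] : Fin 4 → Finset (Fin 27)) vs) (hR4 vs) (c vs) (hci vs) (hcch vs) s hsR
      have hdet := InvertibleAtPairs.det_ne_zero_col β (b μ) c (Mcol μ) (hMa μ hμ) (hMb μ hμ) s Ω hΩ vs bb cc dd h1 h2 h3 h4 h5 h6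
        hMab hMac hMad hMcd (fun i hi => hcch i s (hsR' i hi)) hsees
      exact ZKEntries.z_ne_zero_of_det (β.w s) (b μ) Ω hΩ hdet _ hu
    · -- rank-one cell: explicit output shape with kill index `Mcol μ a`
      have hpm' : K4Defs.pairMask (colcode μ) vs = false := by
        cases h : K4Defs.pairMask (colcode μ) vs
        · rfl
        · exact absurd h hpm
      obtain ⟨a, bb, hab, hva, hvb, hsame, hkills⟩ := K4Codes.offpair_data (colcode μ) vs hpm'
      have hMab : Mcol μ a = Mcol μ bb := (hcolcode μ hμ a bb).mpr hsame
      obtain ⟨ω, hω⟩ := hMf μ hμ a bb vs hab hMab hva hvb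
      -- ω ≠ 0: `s` sees the cheap outputs of its own row
      have hω0 : ω ≠ 0 := by
        intro h0
        obtain ⟨m, hm⟩ := RowSubcomp.sees_cheap_output β _ (hnu vs) ((![{15, 16, 17, 18}, {11, 12, 13, 14}, {23, 24, 25, 26}, {19, 20, 21, 22}] : Fin 4 → Finset (Fin 27)) vs) (hR4 vs) (c vs) (hci vs) (hcch vs) s hsR
        apply hm
        have hW0 : β.w s = 0 := by
          funext q; rw [hω q, h0, Pi.zero_apply, zero_smul]; rfl
        rw [hW0, Matrix.vecMul_zero]
        simp
      -- the kill index class differs from the null representative of the block at row `vt`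
      have hane : Mcol μ a ≠ Mcol μ vt := by
        intro h
        have h1 : K4Defs.same (colcode μ) vt a = true := (hcolcode μ hμ vt a).mp h.symm
        rw [← hkills vt] at h1
        rw [hkill] at h1
        exact Bool.false_ne_true h1
      have hk := ZKEntries.kcov_dot_ne_zero (c vt) (b μ) r r₀ (Mcol μ a) (Mcol μ vt) hrr₀ hane hmax (hMa μ hμ vt)
      exact ZKEntries.z_ne_zero_of_rankOne (β.w s) ω _ hω hω0 _ hk
  -- assemble with the z-vector criterion
  refine (ZKEntries.Q_ne_zero_iff Y (β.w s) (fun q jj => β.g t (Matrix.single q jj (1 : ZMod 3))) (fun q => e * (![![1, 0], ![0, 1], ![1, 1], ![1, 2]] : Fin 4 → Fin 2 → ZMod 3) ((![0, 2, 0, 0] : Fin 4 → Fin 4) vt) q) (c vt)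
    ((![![1, 0], ![0, 1], ![1, 1], ![1, 2]] : Fin 4 → Fin 2 → ZMod 3) r) hshape vt hcheap).mpr ⟨hz, ?_⟩
  have hη : (fun q => e * (![![1, 0], ![0, 1], ![1, 1], ![1, 2]] : Fin 4 → Fin 2 → ZMod 3) ((![0, 2, 0, 0] : Fin 4 → Fin 4) vt) q) ⬝ᵥ (Y *ᵥ (![![1, 0], ![0, 1], ![1, 1], ![1, 2]] : Fin 4 → Fin 2 → ZMod 3) vt) = e * ((![![1, 0], ![0, 1], ![1, 1], ![1, 2]] : Fin 4 → Fin 2 → ZMod 3) ((![0, 2, 0, 0] : Fin 4 → Fin 4) vt) ⬝ᵥ (Y *ᵥ (![![1, 0], ![0, 1], ![1, 1], ![1, 2]] : Fin 4 → Fin 2 → ZMod 3) vt)) := by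
    simp only [dotProduct, Fin.sum_univ_two]; ring
  rw [hη]
  exact mul_ne_zero he hY

end K4EntryNonzero

end Summit.MatrixMultiplication.OmegaCensus.SmallFormats
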